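import Literature.NumberTheory.Automorphic.SmoothRepresentation      -- ★ `Representation.fixedPoints`, `mem_fixedPoints`
import Mathlib.LinearAlgebra.PiTensorProduct.Basic
import Mathlib.LinearAlgebra.Basis.VectorSpace
import Mathlib.Analysis.Complex.Basic
import HarnessLib

/-!
# K2·E1 — row 18, (1) IN THE FINITE CASE (first part): the external tensor product representation `⊗_i ρ_i` of `∏_i G_i` on `⨂[ℂ] i, V_i`, the natural map
# `⨂_i V_i^{K_i} → (⨂_i V_i)^{∏_i K_i}` — INJECTIVE (over a field) and landing in the fixed vectors — and the operator factorisation for group elements;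
# the EXHAUSTION «every `∏K_i`-fixed tensor comes from `⨂ V_i^{K_i}`» (averaging projectors) is named as the one residual

Track B ∕ K2-LIT, crux h413 = `stmt-HodgeConjecture-24833`, route of record `HCCMUnconditional`; cell `hodgecm-mathlib`, squad K2; prover seat `hodgecm-mathlib-K2E1-p08` (g0),
BY-NAME DEAL of the dealer K2E1-plan (g0) 2026-09-03T22:45:06Z; lane `--supports stmt-HodgeConjecture-24833 --as helper` (count-neutral).  ONE definition (`piTensorRep`) +
theorems; no instance, no notation, no axiom, no `sorry`.  HONEST LABEL: HC_CM is proved only modulo the 7 printed citations (2 remaining named inputs: hLiu418 =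
`stmt-HodgeConjecture-24832`, h413 = `stmt-HodgeConjecture-24833`) until rung 0 closes; this file proves no printed statement of the line.

THE MATHEMATICS [FlathCorvallis1979 §2; Bump1997 §3.4 (Thm. 3.4.2 ff.)].  For a finite family of representations `ρ_i : G_i → GL(V_i)` over `ℂ` and subgroups `K_i ≤ G_i`:
* §1 `piTensorRep ρ : Representation ℂ (∀ i, G_i) (⨂[ℂ] i, V_i)`, `g ↦ ⊗_i ρ_i(g_i)` (Mathlib `PiTensorProduct.mapMonoidHom` ∘ the product of the `ρ_i`); `piTensorRep_tprod`.
* §2 `fixedTensorMap ρ K := PiTensorProduct.map (fun i => (V_i^{K_i}).subtype) : ⨂_i V_i^{K_i} →ₗ ⨂_i V_i` — its range lies in `(⨂V_i)^{∏K_i}` (`fixedTensorMap_mem_fixedPoints`,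
  `range_fixedTensorMap_le`); it is INJECTIVE (`fixedTensorMap_injective`: over a field each inclusion has a left inverse, and `⊗` of left inverses is a left inverse —
  `PiTensorProduct.map_comp`∕`map_id`; Mathlib has no `PiTensorProduct.map_injective`); OPERATOR FACTORISATION for group elements of `∏K`-normalising type is the
  functoriality `piTensorRep ρ g ∘ map f = map (ρ_i(g_i) ∘ f_i)` (`piTensorRep_comp_map`).
* §3 THE RESIDUAL, NAMED: `FixedTensorExhaust ρ K := (piTensorRep ρ).fixedPoints (Subgroup.pi univ K) ≤ range (fixedTensorMap ρ K)` — «every `∏K_i`-fixed tensor is a sum of pure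
  tensors of `K_i`-fixed vectors».  In print this is the averaging-projector argument for SMOOTH `ρ_i` and COMPACT OPEN `K_i` (`e_{∏K} = ⊗ e_{K_i}`, ★ `SmoothProjector`); it is kept
  as an explicit hypothesis here (the remaining row-18 (1) debt).  ERRATUM (ED. 2, docstrings only, every declaration unchanged): edition 1 said the exhaustion is «false
  without smoothness∕compactness in general» — WRONG: over a field it holds for EVERY family of representations and subgroups, by pure linear algebra — for a basis `(u_β)` of
  `U := ⨂_{i≠j} V_i`, a `K_j`-fixed `x = Σ_β v_β ⊗ u_β` has every `v_β ∈ V_j^{K_j}` (uniqueness of coefficients), i.e. `(V_j ⊗ U)^{K_j} = V_j^{K_j} ⊗ U`, and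
  `⋂_j (V_1 ⊗ ⋯ ⊗ V_j^{K_j} ⊗ ⋯ ⊗ V_n) = ⨂_j V_j^{K_j}` (bases adapted to `V_j = V_j^{K_j} ⊕ C_j`); no averaging, no topology.  The proof plan in tensor-basis form
  (Mathlib `Basis.piTensorProduct` over bases adapted via `Submodule.prodEquivOfIsCompl`; coefficient comparison slot by slot) is recorded on the K2 bus (K2E1-p08 (g0),
  2026-09-03 ≈ 23:00Z) for the seat that discharges it.  GIVEN it,
  `fixedTensorEquiv` : `⨂_i V_i^{K_i} ≃ₗ (⨂_i V_i)^{∏K_i}` (`LinearEquiv.ofBijective`) — the `Φ` of ★ `K2E1FlathSmoothLayer.smoothTrace_eq_prod_of_factorisation` for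
  `π := piTensorRep ρ`, `K_S := ∏ K_i`; the operators half of `hΦ` (Fubini for the integrated operators of a pure tensor under the product measure) is the other residual,
  not touched here.

References: [FlathCorvallis1979] D. Flath, PSPM 33.1 (1979), §2; [Bump1997] D. Bump, *Automorphic forms and representations*, §3.4.
-/

set_option autoImplicit false
-- the mandated namespace repeats the single-problem summit's segment (`HodgeConjecture.HodgeConjecture`)
set_option linter.dupNamespace false

noncomputable section

open scoped TensorProduct
open PiTensorProduct

namespace Summit.HodgeConjecture.HodgeConjecture.Cruxes.H413.K2E1FixedVectorsTensorFactor

variable {ι : Type} {G : ι → Type} [∀ i, Group (G i)] {V : ι → Type} [∀ i, AddCommGroup (V i)] [∀ i, Module ℂ (V i)]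
  (ρ : ∀ i, Representation ℂ (G i) (V i)) (K : ∀ i, Subgroup (G i))

/-! ## §1 The external tensor product representation of the finite product group -/

/-- **`piTensorRep ρ` — the external tensor product `⊗_i ρ_i` of the finite product group `∏_i G_i` on `⨂[ℂ] i, V_i`**: `g ↦ ⊗_i ρ_i(g_i)` (Mathlib
`PiTensorProduct.mapMonoidHom` composed with `MonoidHom.pi`, `g ↦ (ρ_i(g_i))_i`); any index type `ι`.  [cite: Bump1997, §3.4] [cite: FlathCorvallis1979, §2] -/
def piTensorRep : Representation ℂ (∀ i, G i) (⨂[ℂ] i, V i) :=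
  PiTensorProduct.mapMonoidHom.comp (MonoidHom.pi fun i => (ρ i).comp (Pi.evalMonoidHom G i))

/-- `piTensorRep ρ g = ⊗_i ρ_i(g_i)` as a linear map. [cite: Bump1997, §3.4] -/
theorem piTensorRep_apply (g : ∀ i, G i) : piTensorRep ρ g = PiTensorProduct.map (fun i => ρ i (g i)) := rfl

/-- On pure tensors: `(⊗_i ρ_i)(g) (⊗_i v_i) = ⊗_i ρ_i(g_i) v_i`. [cite: Bump1997, §3.4] -/
theorem piTensorRep_tprod (g : ∀ i, G i) (v : ∀ i, V i) :
    piTensorRep ρ g (tprod ℂ v) = tprod ℂ (fun i => ρ i (g i) (v i)) := by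
  rw [piTensorRep_apply, PiTensorProduct.map_tprod]

/-- **Operator factorisation for group elements** (functoriality): `(⊗_i ρ_i)(g) ∘ (⊗_i f_i) = ⊗_i (ρ_i(g_i) ∘ f_i)`. [cite: Bump1997, §3.4] -/
theorem piTensorRep_comp_map {W : ι → Type} [∀ i, AddCommGroup (W i)] [∀ i, Module ℂ (W i)] (g : ∀ i, G i) (f : ∀ i, W i →ₗ[ℂ] V i) :
    (piTensorRep ρ g) ∘ₗ PiTensorProduct.map f = PiTensorProduct.map (fun i => (ρ i (g i)) ∘ₗ f i) := by
  rw [piTensorRep_apply, ← PiTensorProduct.map_comp]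

/-! ## §2 The natural map `⨂_i V_i^{K_i} → ⨂_i V_i`: lands in the `∏K_i`-fixed vectors, and is injective -/

/-- **`fixedTensorMap ρ K : ⨂_i V_i^{K_i} →ₗ ⨂_i V_i`** — the tensor product of the inclusions `V_i^{K_i} ↪ V_i` (★ `Representation.fixedPoints`). [cite: FlathCorvallis1979, §2] -/
def fixedTensorMap : (⨂[ℂ] i, (ρ i).fixedPoints (K i)) →ₗ[ℂ] ⨂[ℂ] i, V i :=
  PiTensorProduct.map fun i => ((ρ i).fixedPoints (K i)).subtype

/-- On pure tensors `fixedTensorMap` is the inclusion. [cite: FlathCorvallis1979, §2] -/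
theorem fixedTensorMap_tprod (x : ∀ i, (ρ i).fixedPoints (K i)) :
    fixedTensorMap ρ K (tprod ℂ x) = tprod ℂ (fun i => (x i : V i)) := by
  rw [fixedTensorMap, PiTensorProduct.map_tprod]
  rfl

/-- **The image of `⨂_i V_i^{K_i}` consists of `∏_i K_i`-FIXED tensors**: for `k ∈ ∏ K_i`, `(⊗ρ_i)(k)` fixes `fixedTensorMap x` (check on pure tensors: `ρ_i(k_i) x_i = x_i`).
[cite: FlathCorvallis1979, §2] [cite: Bump1997, §3.4] -/
theorem fixedTensorMap_mem_fixedPoints (x : ⨂[ℂ] i, (ρ i).fixedPoints (K i)) :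
    fixedTensorMap ρ K x ∈ (piTensorRep ρ).fixedPoints (Subgroup.pi Set.univ K) := by
  rw [Representation.mem_fixedPoints]
  intro k hk
  -- both sides are linear in `x`; compare the two linear maps on pure tensors
  have hmaps : (piTensorRep ρ k) ∘ₗ fixedTensorMap ρ K = fixedTensorMap ρ K := by
    rw [fixedTensorMap, piTensorRep_comp_map]
    congr 1
    funext i
    apply LinearMap.ext
    intro v
    have hv : ρ i (k i) (v : V i) = v := ((Representation.mem_fixedPoints (ρ i) (K i) v).1 v.2) (k i) (hk i (Set.mem_univ i))
    simpa using hv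
  exact LinearMap.congr_fun hmaps x

/-- The range of `fixedTensorMap` lies in the `∏K_i`-fixed vectors. [cite: FlathCorvallis1979, §2] -/
theorem range_fixedTensorMap_le :
    LinearMap.range (fixedTensorMap ρ K) ≤ (piTensorRep ρ).fixedPoints (Subgroup.pi Set.univ K) := by
  rintro _ ⟨x, rfl⟩
  exact fixedTensorMap_mem_fixedPoints ρ K x

/-- **`⊗` of injective linear maps of vector spaces is injective** (each has a left inverse over a field, `LinearMap.exists_leftInverse_of_injective`; `⊗` of the left inverses is
a left inverse by functoriality `PiTensorProduct.map_comp` ∕ `map_id`).  Mathlib has no `PiTensorProduct.map_injective`. [cite: Bump1997, §3.4] -/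
theorem map_injective_of_injective {W : ι → Type} [∀ i, AddCommGroup (W i)] [∀ i, Module ℂ (W i)] (f : ∀ i, W i →ₗ[ℂ] V i)
    (hf : ∀ i, Function.Injective (f i)) : Function.Injective (PiTensorProduct.map f) := by
  have hleft : ∀ i, ∃ g : V i →ₗ[ℂ] W i, g ∘ₗ f i = LinearMap.id :=
    fun i => (f i).exists_leftInverse_of_injective (LinearMap.ker_eq_bot.mpr (hf i))
  choose g hg using hleft
  have hcomp : PiTensorProduct.map g ∘ₗ PiTensorProduct.map f = LinearMap.id := by
    rw [← PiTensorProduct.map_comp]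
    have : (fun i => g i ∘ₗ f i) = fun i => (LinearMap.id : W i →ₗ[ℂ] W i) := funext hg
    rw [this, PiTensorProduct.map_id]
  intro x y hxy
  have h := congrArg (PiTensorProduct.map g) hxy
  have hx := LinearMap.congr_fun hcomp x
  have hy := LinearMap.congr_fun hcomp y
  simp only [LinearMap.coe_comp, Function.comp_apply, LinearMap.id_coe, id_eq] at hx hy
  rw [hx, hy] at h
  exact h

/-- **`fixedTensorMap` is injective.** [cite: FlathCorvallis1979, §2] [cite: Bump1997, §3.4] -/
theorem fixedTensorMap_injective : Function.Injective (fixedTensorMap ρ K) :=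
  map_injective_of_injective (fun i => ((ρ i).fixedPoints (K i)).subtype) (fun _ => Subtype.val_injective)

/-! ## §3 The residual «exhaustion» and the equivalence `Φ` it yields -/

/-- **THE RESIDUAL (1)-EXHAUSTION**: every `∏_i K_i`-fixed tensor lies in the image of `⨂_i V_i^{K_i}`.  TRUE — in print by the averaging projectors for smooth `ρ_i` and
compact open `K_i` (`e_{∏K} = ⊗_i e_{K_i}`, ★ `SmoothProjector`), and in fact for EVERY family over a field by linear algebra (ED. 2 erratum in the module docstring: uniqueness
of coefficients in a tensor basis); kept as a named hypothesis here (a PREDICATE of `ρ, K`, not a closed fact) — the remaining row-18 (1) debt is its PROOF.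
(print: Bump1997, §3.4) (print: FlathCorvallis1979, §2) -/
def FixedTensorExhaust {ι : Type} {G : ι → Type} [∀ i, Group (G i)] {V : ι → Type} [∀ i, AddCommGroup (V i)] [∀ i, Module ℂ (V i)]
    (ρ : ∀ i, Representation ℂ (G i) (V i)) (K : ∀ i, Subgroup (G i)) : Prop :=
  (piTensorRep ρ).fixedPoints (Subgroup.pi Set.univ K) ≤ LinearMap.range (fixedTensorMap ρ K)

/-- **`Φ : ⨂_i V_i^{K_i} ≃ₗ (⨂_i V_i)^{∏K_i}` GIVEN the exhaustion** — injective by §2, onto by hypothesis; the `Φ` consumed by ★ `K2E1FlathSmoothLayer.smoothTrace_eq_prod_of_factorisation`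
for `π := piTensorRep ρ`, `K_S := ∏_i K_i`. [cite: FlathCorvallis1979, §2 Thm. 3] [cite: Bump1997, §3.4] -/
def fixedTensorEquiv (h : FixedTensorExhaust ρ K) :
    (⨂[ℂ] i, (ρ i).fixedPoints (K i)) ≃ₗ[ℂ] (piTensorRep ρ).fixedPoints (Subgroup.pi Set.univ K) :=
  LinearEquiv.ofBijective ((fixedTensorMap ρ K).codRestrict _ (fixedTensorMap_mem_fixedPoints ρ K))
    ⟨fun x y hxy => fixedTensorMap_injective ρ K (congrArg Subtype.val hxy),
     fun w => by
      obtain ⟨x, hx⟩ := h w.2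
      exact ⟨x, Subtype.ext hx⟩⟩

/-- `fixedTensorEquiv` is `fixedTensorMap` on underlying vectors. [cite: FlathCorvallis1979, §2] -/
theorem coe_fixedTensorEquiv_apply (h : FixedTensorExhaust ρ K) (x : ⨂[ℂ] i, (ρ i).fixedPoints (K i)) :
    ((fixedTensorEquiv ρ K h x : (piTensorRep ρ).fixedPoints (Subgroup.pi Set.univ K)) : ⨂[ℂ] i, V i) = fixedTensorMap ρ K x :=
  rfl

end Summit.HodgeConjecture.HodgeConjecture.Cruxes.H413.K2E1FixedVectorsTensorFactor

end
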